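import Mathlib
import Summits.Ventures.PercRepro2.Defs
import Summits.Ventures.PercRepro2.Harris
import Summits.Ventures.PercRepro2.CoinDefs
import Summits.Ventures.PercRepro2.CoinStarDefs
import Summits.Ventures.PercRepro2.CoinLsmCoreDefs
import Summits.Ventures.PercRepro2.CoinLsmCoreU
import Summits.Ventures.PercRepro2.CoinCoreGate
import Summits.Ventures.PercRepro2.CoinOrTailKDefs
import Summits.Ventures.PercRepro2.CoinOrTailKSums
import Summits.Ventures.PercRepro2.CoinOrTailLsmCore
import Summits.Ventures.PercRepro2.CoinTreeCore
import Summits.Ventures.PercRepro2.CoinKSureCore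
import Summits.Ventures.PercRepro2.CoinKSureTailSums
import Summits.Ventures.PercRepro2.CoinKSureGen

/-!
# The OR-closure of a head, erased and starred (blind cell PercRepro2, night-2 g15;
proofs/NIGHT2-DARC.md §53)

Support lemmas for a marker at a SECOND sure OR-vertex `b` of the head: the OR-closure
`closeB entb b A` (`CoinKSureGen`) composed with `starTarget` on the core levels
(`closeB_star_of_notMem`, `closeB_star_insert`), the `b`-ERASED closure `closeBE` — log-supermodular
on ALL sets (`closeBE_lsm`), which the abstract theorem `orTailKSure_functional_nonneg_markers`
needs — and its agreement with `closeB` inside `rValK` / `gValK` on the core levels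
(`rValK_closeBE`, `gValK_closeBE`).
-/

namespace Summit.Ventures.PercRepro2.Coin

open Classical

section StarClose

variable {V : Type*} [DecidableEq V] {R : Type*} [Field R]

omit [Field R] in
/-- The OR-closure of the gate head on a level without `a` is the OR-closure of the head. -/
lemma closeB_star_of_notMem (entb : Finset V) {a b w : V} (A : Finset V → R) {W : Finset V}
    (haW : a ∉ W) (hba : b ≠ a) :
    closeB entb b (fun X => A (starTarget a w X)) W = closeB entb b A W := by
  unfold closeB
  have h1 : starTarget a w W = W := by
    unfold starTarget
    rw [if_neg haW]
  have h2 : starTarget a w (W ∪ {b}) = W ∪ {b} := by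
    have : a ∉ W ∪ {b} := by
      rw [Finset.mem_union, Finset.mem_singleton, not_or]
      exact ⟨haW, Ne.symm hba⟩
    unfold starTarget
    rw [if_neg this]
  simp only [h1, h2]

omit [Field R] in
/-- The OR-closure of the gate head on a level with `a` added is the OR-closure of the head with
`a` and `w` added. -/
lemma closeB_star_insert (entb : Finset V) {a b w : V} (A : Finset V → R) {W : Finset V}
    (hae : a ∉ entb) (hwe : w ∉ entb) :
    closeB entb b (fun X => A (starTarget a w X)) (W ∪ {a}) = closeB entb b A (W ∪ {a, w}) := by
  unfold closeB
  have hent : (∃ r ∈ entb, r ∈ W ∪ {a}) ↔ ∃ r ∈ entb, r ∈ W ∪ {a, w} := by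
    constructor
    · rintro ⟨r, hr, hrW⟩
      refine ⟨r, hr, ?_⟩
      rw [Finset.mem_union, Finset.mem_singleton] at hrW
      rcases hrW with h | rfl
      · exact Finset.mem_union_left _ h
      · exact absurd hr hae
    · rintro ⟨r, hr, hrW⟩
      refine ⟨r, hr, ?_⟩
      rw [Finset.mem_union, Finset.mem_insert, Finset.mem_singleton] at hrW
      rcases hrW with h | rfl | rfl
      · exact Finset.mem_union_left _ h
      · exact absurd hr hae
      · exact absurd hr hwe
  have h1 : starTarget a w (W ∪ {a}) = W ∪ {a, w} := by
    have : a ∈ W ∪ {a} := Finset.mem_union_right _ (Finset.mem_singleton_self a)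
    simp only [starTarget, this, if_true]
    ext x
    simp only [Finset.mem_insert, Finset.mem_union, Finset.mem_singleton]
    tauto
  have h2 : starTarget a w (W ∪ {a} ∪ {b}) = W ∪ {a, w} ∪ {b} := by
    have : a ∈ W ∪ {a} ∪ {b} :=
      Finset.mem_union_left _ (Finset.mem_union_right _ (Finset.mem_singleton_self a))
    simp only [starTarget, this, if_true]
    ext x
    simp only [Finset.mem_insert, Finset.mem_union, Finset.mem_singleton]
    tauto
  simp only [h1, h2]
  rw [if_congr hent rfl rfl]

end StarClose


section CloseErase

variable {V : Type*} [DecidableEq V] {R : Type*} [Field R] [LinearOrder R] [IsStrictOrderedRing R]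

omit [Field R] [LinearOrder R] [IsStrictOrderedRing R] in
/-- `(s ∩ t).erase b = s.erase b ∩ t.erase b`. -/
lemma erase_inter_distrib' (s t : Finset V) (b : V) :
    (s ∩ t).erase b = s.erase b ∩ t.erase b := by
  ext x
  simp only [Finset.mem_erase, Finset.mem_inter]
  tauto

/-- The OR-closure with `b` erased first: a head that is log-supermodular on ALL sets. -/
noncomputable def closeBE (entb : Finset V) (b : V) (F : Finset V → R) (X : Finset V) : R :=
  closeB entb b F (X.erase b)

omit [Field R] [LinearOrder R] [IsStrictOrderedRing R] in
/-- On a set without `b`, `closeBE` is `closeB`. -/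
lemma closeBE_of_notMem (entb : Finset V) (b : V) (F : Finset V → R) {X : Finset V}
    (hb : b ∉ X) : closeBE entb b F X = closeB entb b F X := by
  unfold closeBE
  rw [Finset.erase_eq_of_notMem hb]

omit [IsStrictOrderedRing R] in
/-- `closeBE` of a nonnegative head is nonnegative. -/
lemma closeBE_nonneg (entb : Finset V) (b : V) (F : Finset V → R) (hF0 : ∀ W, 0 ≤ F W)
    (X : Finset V) : 0 ≤ closeBE entb b F X :=
  closeB_nonneg entb b F hF0 _

omit [Field R] [IsStrictOrderedRing R] in
/-- `closeBE` of a decreasing head is decreasing. -/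
lemma closeBE_mono (entb : Finset V) (b : V) (F : Finset V → R)
    (hmono : ∀ s t : Finset V, s ⊆ t → F t ≤ F s) :
    ∀ s t : Finset V, s ⊆ t → closeBE entb b F t ≤ closeBE entb b F s :=
  fun _ _ hst => closeB_mono entb b F hmono _ _ (Finset.erase_subset_erase b hst)

/-- `closeBE` of a nonnegative, decreasing, log-supermodular head is log-supermodular on ALL
sets. -/
lemma closeBE_lsm (entb : Finset V) (b : V) (F : Finset V → R) (hF0 : ∀ W, 0 ≤ F W)
    (hF : ∀ s t : Finset V, F s * F t ≤ F (s ∩ t) * F (s ∪ t))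
    (hmono : ∀ s t : Finset V, s ⊆ t → F t ≤ F s) :
    ∀ s t : Finset V, closeBE entb b F s * closeBE entb b F t ≤
      closeBE entb b F (s ∩ t) * closeBE entb b F (s ∪ t) := by
  intro s t
  unfold closeBE
  rw [erase_inter_distrib', Finset.erase_union_distrib]
  exact closeB_lsm entb b F hF0 hF hmono (Finset.notMem_erase b s) (Finset.notMem_erase b t)

end CloseErase


section CloseBEVals

variable {V : Type*} {E : Type*} [Fintype V] [DecidableEq V] [Fintype E] [DecidableEq E]
  {R : Type*} [Field R] [LinearOrder R] [IsStrictOrderedRing R]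
  {arcs : E → Finset (V × V)} {s : V} {U : Finset V} {ent : Finset V} {c : V → E} {a w : V}
  {entb : Finset V} {d : V → E} {b : V}

omit [Fintype V] [Fintype E] [DecidableEq E] [LinearOrder R] [IsStrictOrderedRing R] in
/-- `rValK` does not see the `b`-erasure on `b`-free levels. -/
lemma rValK_closeBE (A : Finset V → R) (pr : E → R) {W : Finset V} (hbW : b ∉ W) (hba : b ≠ a) :
    rValK (closeBE entb b A) pr ent c a W = rValK (closeB entb b A) pr ent c a W := by
  unfold rValK
  have h2 : b ∉ W ∪ {a} := by
    rw [Finset.mem_union, Finset.mem_singleton, not_or]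
    exact ⟨hbW, hba⟩
  rw [closeBE_of_notMem entb b A hbW, closeBE_of_notMem entb b A h2]

omit [Fintype V] [Fintype E] [DecidableEq E] [LinearOrder R] [IsStrictOrderedRing R] in
/-- `gValK` does not see the `b`-erasure on `b`-free levels. -/
lemma gValK_closeBE (A : Finset V → R) (pr : E → R) {W : Finset V} (hbW : b ∉ W) (hba : b ≠ a)
    (hbw : b ≠ w) :
    gValK (closeBE entb b A) pr ent c a w W = gValK (closeB entb b A) pr ent c a w W := by
  unfold gValK
  have h2 : b ∉ W ∪ {a, w} := by
    rw [Finset.mem_union, Finset.mem_insert, Finset.mem_singleton, not_or, not_or]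
    exact ⟨hbW, hba, hbw⟩
  rw [closeBE_of_notMem entb b A hbW, closeBE_of_notMem entb b A h2]

end CloseBEVals

end Summit.Ventures.PercRepro2.Coin
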